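import Mathlib
import Summits.AnomalousDissipation.AnomalousDissipation.Theorems.DyadicWallCascadeHalfSpaceHierarchySlabExtension

/-!
# Stub `stub_cellToBand` of the line `bernoulli-surface-topology` — crux `DyadicWallCascade.HalfSpaceHierarchy`
# (item stmt-AnomalousDissipation-18627): a cell solution with exact collars is a band profile

Sorry-free discharge of the registered gluing stub `stub_cellToBand` of the lead's skeleton
(`Cruxes/HalfSpaceHierarchy/Lines/bernoulli_surface_topology.lean`, §3).

**Statement.**  Let `G, PG` be smooth on `ℝ³`, `0 < η < 1/2`, and `(U, P)` a *cell solution*: smooth on the open slab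
`{1-η < z < 2+η}` (`z = X 2`), divergence free and steady Euler on the open band `{1 < z < 2}`, `1`-periodic in `x, y`
on the closed band `{1 ≤ z ≤ 2}`, equal to `(G, PG)` on the top collar `{2-η < z < 2+η}` and to `(G, PG) ∘ (2 •)` on the
bottom collar `{1-η < z < 1+η}`, whose bottom-trace flux integrals over the unit square are `0` (mass) and `F ≠ 0`
(energy).  Then there is a *band profile* `(V, Q, F)` — verbatim the antecedent of the landed `stub_slabOfBand`
(`Theorems/DyadicWallCascadeHalfSpaceHierarchySlabOfBand.lean`): smooth on the open slab `{1/2 < z < 4}`, divergence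
free and steady Euler on the open band, `V (2X) = V X`, `Q (2X) = Q X` for `1/2 < z < 2`, band-periodic, with the two
flux clauses at `z = 1`.

**Proof (pure gluing, no PDE).**  The witnesses are the three-piece gluings `V := U (2 •)` on `{z < 1}`, `U` on
`{1 ≤ z ≤ 2}`, `U (2⁻¹ •)` on `{2 < z}` (same for `Q` from `P`), packaged abstractly by `cellToBand_exists_glue`
(a function `v` with the three branch identities).  The one geometric fact is the AGREEMENT LEMMA `cellToBand_agree`:
by the two collar identities `v = u` on the OPEN band `{1 - η/2 < z < 2 + η} ⊇ {1 ≤ z ≤ 2}` (below `1` both sides are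
`g (2 •)`, above `2` both are `g`).  Hence `v` is, on each of the three open pieces `{1/2 < z < 1}`,
`{1 - η/2 < z < 2 + η}`, `{2 < z < 4}` covering the slab, a smooth function (`u ∘ (2 •)`, `u`, `u ∘ (2⁻¹ •)`), so it is
`C^∞` on the slab (`cellToBand_contDiffOn`, via `contDiffOn_of_locally_contDiffOn`); `v = u` near every point of the
open band (`cellToBand_eventuallyEq`), so `fderiv` and `gradient` — hence divergence and the Euler equation — transfer
verbatim; the dilation relation holds by the case split `z < 1` / `z = 1` / `z > 1` (`cellToBand_dilation`, the middle
case again by the collar identities); periodicity lives on the closed band where `v = u` (`cellToBand_periodic`); and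
the trace `v (x, y, 1) = u (x, y, 1) = g (2 • (x, y, 1))` (`cellToBand_trace`, bottom collar) rewrites the two flux
clauses into the hypotheses.  Only `0 < η` is used (not `η < 1/2`, not the smoothness or the equation of `G`).  Folklore.
-/

-- `Summit.<Summit>.<Problem>` is the tree's mandated summit-side namespace (CONVENTIONS §2); for this
-- single-conjunct summit the two coincide, so the duplicate is deliberate.
set_option linter.dupNamespace false

open scoped Topology InnerProductSpace
open MeasureTheory Filter Set

noncomputable section

namespace Summit.AnomalousDissipation.AnomalousDissipation.Theorems.HalfSpaceHierarchy

/-! ### The three-piece gluing and its agreement with the cell solution near the band -/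

/-- **The gluing.**  For any `u` there is a function `v` with `v = u (2 •)` on `{z < 1}`, `v = u` on `{1 ≤ z ≤ 2}` and
`v = u (2⁻¹ •)` on `{2 < z}` (an `if`-cascade on the height; only these three branch identities are used below). -/
theorem cellToBand_exists_glue {α : Type*} (u : EuclideanSpace ℝ (Fin 3) → α) :
    ∃ v : EuclideanSpace ℝ (Fin 3) → α,
      (∀ X : EuclideanSpace ℝ (Fin 3), X 2 < 1 → v X = u ((2 : ℝ) • X)) ∧
      (∀ X : EuclideanSpace ℝ (Fin 3), 1 ≤ X 2 → X 2 ≤ 2 → v X = u X) ∧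
      (∀ X : EuclideanSpace ℝ (Fin 3), 2 < X 2 → v X = u ((2 : ℝ)⁻¹ • X)) := by
  refine ⟨fun X => if X 2 < 1 then u ((2 : ℝ) • X) else if X 2 ≤ 2 then u X else u ((2 : ℝ)⁻¹ • X),
    fun X h => ?_, fun X h1 h2 => ?_, fun X h => ?_⟩
  · simp only [if_pos h]
  · simp only [if_neg (not_lt.mpr h1), if_pos h2]
  · have h1 : ¬ X 2 < 1 := fun h' => by linarith
    simp only [if_neg h1, if_neg (not_le.mpr h)]

/-- **Agreement lemma.**  With the collar identities `u = g` on `{2-η < z < 2+η}` and `u = g (2 •)` on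
`{1-η < z < 1+η}`, the gluing `v` coincides with `u` on the open band `{1 - η/2 < z < 2 + η}` (which contains the
closed band `{1 ≤ z ≤ 2}`): below `1` both are `g (2 •)`, above `2` both are `g`. -/
theorem cellToBand_agree {α : Type*} {u g v : EuclideanSpace ℝ (Fin 3) → α} {η : ℝ}
    (htop : ∀ X : EuclideanSpace ℝ (Fin 3), 2 - η < X 2 → X 2 < 2 + η → u X = g X)
    (hbot : ∀ X : EuclideanSpace ℝ (Fin 3), 1 - η < X 2 → X 2 < 1 + η → u X = g ((2 : ℝ) • X))
    (hv1 : ∀ X : EuclideanSpace ℝ (Fin 3), X 2 < 1 → v X = u ((2 : ℝ) • X))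
    (hv2 : ∀ X : EuclideanSpace ℝ (Fin 3), 1 ≤ X 2 → X 2 ≤ 2 → v X = u X)
    (hv3 : ∀ X : EuclideanSpace ℝ (Fin 3), 2 < X 2 → v X = u ((2 : ℝ)⁻¹ • X))
    {X : EuclideanSpace ℝ (Fin 3)} (h1 : 1 - η / 2 < X 2) (h2 : X 2 < 2 + η) : v X = u X := by
  have h2X : ((2 : ℝ) • X) 2 = 2 * X 2 := by simp
  have hX2 : ((2 : ℝ)⁻¹ • X) 2 = 2⁻¹ * X 2 := by simp
  by_cases hlt : X 2 < 1
  · rw [hv1 X hlt, htop _ (by rw [h2X]; linarith) (by rw [h2X]; linarith), hbot X (by linarith) (by linarith)]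
  · by_cases hle : X 2 ≤ 2
    · exact hv2 X (not_lt.mp hlt) hle
    · push Not at hlt hle
      rw [hv3 X hle, hbot ((2 : ℝ)⁻¹ • X) (by rw [hX2]; linarith) (by rw [hX2]; linarith), smul_smul,
        mul_inv_cancel₀ (two_ne_zero : (2 : ℝ) ≠ 0), one_smul, htop X (by linarith) h2]

/-! ### Smoothness on the slab, local form on the open band -/

/-- **Smoothness.**  If `u` is `C^∞` on `{1-η < z < 2+η}` and the collar identities hold, the gluing `v` is `C^∞` on the
open slab `{1/2 < z < 4}`: on the open cover `{1/2 < z < 1}`, `{1 - η/2 < z < 2 + η}`, `{2 < z < 4}` it is respectively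
`u ∘ (2 •)`, `u` (agreement lemma), `u ∘ (2⁻¹ •)`, and `contDiffOn` is a local property. -/
theorem cellToBand_contDiffOn {F' : Type*} [NormedAddCommGroup F'] [NormedSpace ℝ F']
    {u g v : EuclideanSpace ℝ (Fin 3) → F'} {η : ℝ} (hη : 0 < η)
    (hu : ContDiffOn ℝ ((⊤ : ℕ∞) : WithTop ℕ∞) u {Y : EuclideanSpace ℝ (Fin 3) | 1 - η < Y 2 ∧ Y 2 < 2 + η})
    (htop : ∀ X : EuclideanSpace ℝ (Fin 3), 2 - η < X 2 → X 2 < 2 + η → u X = g X)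
    (hbot : ∀ X : EuclideanSpace ℝ (Fin 3), 1 - η < X 2 → X 2 < 1 + η → u X = g ((2 : ℝ) • X))
    (hv1 : ∀ X : EuclideanSpace ℝ (Fin 3), X 2 < 1 → v X = u ((2 : ℝ) • X))
    (hv2 : ∀ X : EuclideanSpace ℝ (Fin 3), 1 ≤ X 2 → X 2 ≤ 2 → v X = u X)
    (hv3 : ∀ X : EuclideanSpace ℝ (Fin 3), 2 < X 2 → v X = u ((2 : ℝ)⁻¹ • X)) :
    ContDiffOn ℝ ((⊤ : ℕ∞) : WithTop ℕ∞) v {Y : EuclideanSpace ℝ (Fin 3) | 1 / 2 < Y 2 ∧ Y 2 < 4} := by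
  apply contDiffOn_of_locally_contDiffOn
  intro X hX
  obtain ⟨hX1, hX4⟩ := hX
  by_cases hlt : X 2 < 1
  · -- below the band: `v = u ∘ (2 •)`
    refine ⟨{Y : EuclideanSpace ℝ (Fin 3) | 1 / 2 < Y 2 ∧ Y 2 < 1}, slabExt_isOpen_band _ _, ⟨hX1, hlt⟩, ?_⟩
    have hcomp : ContDiffOn ℝ ((⊤ : ℕ∞) : WithTop ℕ∞) (u ∘ fun Y : EuclideanSpace ℝ (Fin 3) => (2 : ℝ) • Y)
        {Y : EuclideanSpace ℝ (Fin 3) | 1 / 2 < Y 2 ∧ Y 2 < 1} := by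
      refine hu.comp (contDiff_const_smul _).contDiffOn ?_
      intro Y hY
      obtain ⟨a, b⟩ := hY
      simp only [mem_setOf_eq, PiLp.smul_apply, smul_eq_mul]
      constructor <;> linarith
    refine (hcomp.congr ?_).mono inter_subset_right
    intro Y hY
    exact hv1 Y hY.2
  · by_cases hle : X 2 ≤ 2
    · -- near the closed band: `v = u` (agreement lemma)
      refine ⟨{Y : EuclideanSpace ℝ (Fin 3) | 1 - η / 2 < Y 2 ∧ Y 2 < 2 + η}, slabExt_isOpen_band _ _,
        ⟨by linarith [not_lt.mp hlt], by linarith⟩, ?_⟩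
      refine ((hu.mono ?_).congr ?_).mono inter_subset_right
      · intro Y hY
        obtain ⟨a, b⟩ := hY
        exact ⟨by linarith, b⟩
      · intro Y hY
        exact cellToBand_agree htop hbot hv1 hv2 hv3 hY.1 hY.2
    · -- above the band: `v = u ∘ (2⁻¹ •)`
      push Not at hlt hle
      refine ⟨{Y : EuclideanSpace ℝ (Fin 3) | 2 < Y 2 ∧ Y 2 < 4}, slabExt_isOpen_band _ _, ⟨hle, hX4⟩, ?_⟩
      have hcomp : ContDiffOn ℝ ((⊤ : ℕ∞) : WithTop ℕ∞) (u ∘ fun Y : EuclideanSpace ℝ (Fin 3) => (2 : ℝ)⁻¹ • Y)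
          {Y : EuclideanSpace ℝ (Fin 3) | 2 < Y 2 ∧ Y 2 < 4} := by
        refine hu.comp (contDiff_const_smul _).contDiffOn ?_
        intro Y hY
        obtain ⟨a, b⟩ := hY
        simp only [mem_setOf_eq, PiLp.smul_apply, smul_eq_mul]
        constructor <;> linarith
      refine (hcomp.congr ?_).mono inter_subset_right
      intro Y hY
      exact hv3 Y hY.1

/-- **Local form on the open band.**  Near a point of the open band `{1 < z < 2}` the gluing IS `u`. -/
theorem cellToBand_eventuallyEq {α : Type*} {u v : EuclideanSpace ℝ (Fin 3) → α}
    (hv2 : ∀ X : EuclideanSpace ℝ (Fin 3), 1 ≤ X 2 → X 2 ≤ 2 → v X = u X)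
    {X : EuclideanSpace ℝ (Fin 3)} (h1 : 1 < X 2) (h2 : X 2 < 2) : v =ᶠ[𝓝 X] u := by
  filter_upwards [(slabExt_isOpen_band 1 2).mem_nhds ⟨h1, h2⟩] with Y hY
  exact hv2 Y hY.1.le hY.2.le

/-- Hence the gradient of a scalar gluing on the open band is that of `u`. -/
theorem cellToBand_gradient {u v : EuclideanSpace ℝ (Fin 3) → ℝ}
    (hv2 : ∀ X : EuclideanSpace ℝ (Fin 3), 1 ≤ X 2 → X 2 ≤ 2 → v X = u X)
    {X : EuclideanSpace ℝ (Fin 3)} (h1 : 1 < X 2) (h2 : X 2 < 2) : gradient v X = gradient u X :=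
  (cellToBand_eventuallyEq hv2 h1 h2).gradient_eq

/-! ### Dilation relation, periodicity, trace at `z = 1` -/

/-- **Dilation relation.**  `v (2X) = v X` for `1/2 < X₃ < 2`: for `X₃ < 1` both sides are `u (2X)`; for `X₃ = 1`
they are `u (2X) = g (2X)` (top collar) and `u X = g (2X)` (bottom collar); for `X₃ > 1` the left side is
`u (2⁻¹ • 2 • X) = u X`. -/
theorem cellToBand_dilation {α : Type*} {u g v : EuclideanSpace ℝ (Fin 3) → α} {η : ℝ} (hη : 0 < η)
    (htop : ∀ X : EuclideanSpace ℝ (Fin 3), 2 - η < X 2 → X 2 < 2 + η → u X = g X)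
    (hbot : ∀ X : EuclideanSpace ℝ (Fin 3), 1 - η < X 2 → X 2 < 1 + η → u X = g ((2 : ℝ) • X))
    (hv1 : ∀ X : EuclideanSpace ℝ (Fin 3), X 2 < 1 → v X = u ((2 : ℝ) • X))
    (hv2 : ∀ X : EuclideanSpace ℝ (Fin 3), 1 ≤ X 2 → X 2 ≤ 2 → v X = u X)
    (hv3 : ∀ X : EuclideanSpace ℝ (Fin 3), 2 < X 2 → v X = u ((2 : ℝ)⁻¹ • X))
    {X : EuclideanSpace ℝ (Fin 3)} (h1 : 1 / 2 < X 2) (h2 : X 2 < 2) : v ((2 : ℝ) • X) = v X := by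
  have h2X : ((2 : ℝ) • X) 2 = 2 * X 2 := by simp
  rcases lt_trichotomy (X 2) 1 with hlt | heq | hgt
  · rw [hv1 X hlt, hv2 _ (by rw [h2X]; linarith) (by rw [h2X]; linarith)]
  · rw [hv2 _ (by rw [h2X]; linarith) (by rw [h2X]; linarith), hv2 X (by linarith) (by linarith),
      htop _ (by rw [h2X]; linarith) (by rw [h2X]; linarith), hbot X (by linarith) (by linarith)]
  · rw [hv3 _ (by rw [h2X]; linarith), smul_smul, inv_mul_cancel₀ (two_ne_zero : (2 : ℝ) ≠ 0), one_smul,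
      hv2 X hgt.le h2.le]

/-- **Periodicity transfer.**  On the closed band the gluing is `u`, and a horizontal translate stays at the same
height, so periodicity of `u` along a horizontal vector `e` passes to `v`. -/
theorem cellToBand_periodic {α : Type*} {u v : EuclideanSpace ℝ (Fin 3) → α}
    (hv2 : ∀ X : EuclideanSpace ℝ (Fin 3), 1 ≤ X 2 → X 2 ≤ 2 → v X = u X)
    (e : EuclideanSpace ℝ (Fin 3)) (he : e 2 = 0) {X : EuclideanSpace ℝ (Fin 3)} (h1 : 1 ≤ X 2) (h2 : X 2 ≤ 2)
    (hper : u (X + e) = u X) : v (X + e) = v X := by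
  have hXe : (X + e) 2 = X 2 := by simp [he]
  rw [hv2 _ (by rw [hXe]; exact h1) (by rw [hXe]; exact h2), hv2 X h1 h2, hper]

/-- **Trace at `z = 1`.**  On the plane `z = 1` the gluing is `u = g (2 •)` (bottom collar). -/
theorem cellToBand_trace {α : Type*} {u g v : EuclideanSpace ℝ (Fin 3) → α} {η : ℝ} (hη : 0 < η)
    (hbot : ∀ X : EuclideanSpace ℝ (Fin 3), 1 - η < X 2 → X 2 < 1 + η → u X = g ((2 : ℝ) • X))
    (hv2 : ∀ X : EuclideanSpace ℝ (Fin 3), 1 ≤ X 2 → X 2 ≤ 2 → v X = u X) (x y : ℝ) :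
    v !₂[x, y, (1 : ℝ)] = g ((2 : ℝ) • !₂[x, y, (1 : ℝ)]) := by
  have h1 : (!₂[x, y, (1 : ℝ)] : EuclideanSpace ℝ (Fin 3)) 2 = 1 := by simp
  rw [hv2 _ (by rw [h1]) (by rw [h1]; norm_num), hbot _ (by rw [h1]; linarith) (by rw [h1]; linarith)]

/-! ### The registered stub -/

/-- **Stub `stub_cellToBand` (line `bernoulli-surface-topology`, §3; registered): a cell solution with exact collars
is a band profile.**  Witnesses: the three-piece gluings of `U` and of `P` (`cellToBand_exists_glue`) and the given
`F`.  Smoothness on the slab is `cellToBand_contDiffOn`; divergence and Euler on the open band transfer through the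
local form `V = U`, `Q = P` near each of its points (`cellToBand_eventuallyEq`, `Filter.EventuallyEq.fderiv_eq`,
`cellToBand_gradient`); the dilation relation is `cellToBand_dilation`, periodicity `cellToBand_periodic`, and the two
flux clauses are the hypotheses after rewriting the trace `V (x, y, 1) = G (2 • (x, y, 1))`,
`Q (x, y, 1) = PG (2 • (x, y, 1))` (`cellToBand_trace`).  The hypotheses `ContDiff G`, `ContDiff PG`, `η < 1/2` are
not needed. -/
theorem stub_cellToBand :
    ∀ (G : EuclideanSpace ℝ (Fin 3) → EuclideanSpace ℝ (Fin 3)) (PG : EuclideanSpace ℝ (Fin 3) → ℝ)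
      (U : EuclideanSpace ℝ (Fin 3) → EuclideanSpace ℝ (Fin 3)) (P : EuclideanSpace ℝ (Fin 3) → ℝ) (F η : ℝ),
      ContDiff ℝ ((⊤ : ℕ∞) : WithTop ℕ∞) G → ContDiff ℝ ((⊤ : ℕ∞) : WithTop ℕ∞) PG →
      0 < η → η < 1 / 2 →
      ContDiffOn ℝ ((⊤ : ℕ∞) : WithTop ℕ∞) U {Y : EuclideanSpace ℝ (Fin 3) | 1 - η < Y 2 ∧ Y 2 < 2 + η} →
      ContDiffOn ℝ ((⊤ : ℕ∞) : WithTop ℕ∞) P {Y : EuclideanSpace ℝ (Fin 3) | 1 - η < Y 2 ∧ Y 2 < 2 + η} →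
      (∀ X : EuclideanSpace ℝ (Fin 3), 1 < X 2 → X 2 < 2 →
        ∑ i : Fin 3, (fderiv ℝ U X (EuclideanSpace.single i (1 : ℝ))) i = 0) →
      (∀ X : EuclideanSpace ℝ (Fin 3), 1 < X 2 → X 2 < 2 → (fderiv ℝ U X) (U X) + gradient P X = 0) →
      (∀ X : EuclideanSpace ℝ (Fin 3), 1 ≤ X 2 → X 2 ≤ 2 →
        U (X + EuclideanSpace.single 0 (1 : ℝ)) = U X ∧ U (X + EuclideanSpace.single 1 (1 : ℝ)) = U X ∧
        P (X + EuclideanSpace.single 0 (1 : ℝ)) = P X ∧ P (X + EuclideanSpace.single 1 (1 : ℝ)) = P X) →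
      (∀ X : EuclideanSpace ℝ (Fin 3), 2 - η < X 2 → X 2 < 2 + η → U X = G X ∧ P X = PG X) →
      (∀ X : EuclideanSpace ℝ (Fin 3), 1 - η < X 2 → X 2 < 1 + η →
        U X = G ((2 : ℝ) • X) ∧ P X = PG ((2 : ℝ) • X)) →
      (∫ q in Set.Icc (0 : ℝ) 1 ×ˢ Set.Icc (0 : ℝ) 1, (G ((2 : ℝ) • !₂[q.1, q.2, (1 : ℝ)])) 2 = 0) →
      F ≠ 0 →
      (∫ q in Set.Icc (0 : ℝ) 1 ×ˢ Set.Icc (0 : ℝ) 1,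
        (G ((2 : ℝ) • !₂[q.1, q.2, (1 : ℝ)])) 2 *
          (‖G ((2 : ℝ) • !₂[q.1, q.2, (1 : ℝ)])‖ ^ 2 / 2 + PG ((2 : ℝ) • !₂[q.1, q.2, (1 : ℝ)])) = F) →
      ∃ (V : EuclideanSpace ℝ (Fin 3) → EuclideanSpace ℝ (Fin 3)) (Q : EuclideanSpace ℝ (Fin 3) → ℝ) (F : ℝ),
        ContDiffOn ℝ ((⊤ : ℕ∞) : WithTop ℕ∞) V {Y : EuclideanSpace ℝ (Fin 3) | 1 / 2 < Y 2 ∧ Y 2 < 4} ∧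
        ContDiffOn ℝ ((⊤ : ℕ∞) : WithTop ℕ∞) Q {Y : EuclideanSpace ℝ (Fin 3) | 1 / 2 < Y 2 ∧ Y 2 < 4} ∧
        (∀ X : EuclideanSpace ℝ (Fin 3), 1 < X 2 → X 2 < 2 →
          ∑ i : Fin 3, (fderiv ℝ V X (EuclideanSpace.single i (1 : ℝ))) i = 0) ∧
        (∀ X : EuclideanSpace ℝ (Fin 3), 1 < X 2 → X 2 < 2 → (fderiv ℝ V X) (V X) + gradient Q X = 0) ∧
        (∀ X : EuclideanSpace ℝ (Fin 3), 1 / 2 < X 2 → X 2 < 2 → V ((2 : ℝ) • X) = V X ∧ Q ((2 : ℝ) • X) = Q X) ∧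
        (∀ X : EuclideanSpace ℝ (Fin 3), 1 ≤ X 2 → X 2 ≤ 2 →
          V (X + EuclideanSpace.single 0 (1 : ℝ)) = V X ∧ V (X + EuclideanSpace.single 1 (1 : ℝ)) = V X ∧
          Q (X + EuclideanSpace.single 0 (1 : ℝ)) = Q X ∧ Q (X + EuclideanSpace.single 1 (1 : ℝ)) = Q X) ∧
        (∫ q in Set.Icc (0 : ℝ) 1 ×ˢ Set.Icc (0 : ℝ) 1, (V !₂[q.1, q.2, (1 : ℝ)]) 2 = 0) ∧ F ≠ 0 ∧
        (∫ q in Set.Icc (0 : ℝ) 1 ×ˢ Set.Icc (0 : ℝ) 1,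
          (V !₂[q.1, q.2, (1 : ℝ)]) 2 * (‖V !₂[q.1, q.2, (1 : ℝ)]‖ ^ 2 / 2 + Q !₂[q.1, q.2, (1 : ℝ)]) = F) := by
  intro G PG U P F η _hG _hPG hη _hη' hU hP hUdiv hUE hUper htop hbot hm hF he
  obtain ⟨V, hV1, hV2, hV3⟩ := cellToBand_exists_glue U
  obtain ⟨Q, hQ1, hQ2, hQ3⟩ := cellToBand_exists_glue P
  have htopU : ∀ X : EuclideanSpace ℝ (Fin 3), 2 - η < X 2 → X 2 < 2 + η → U X = G X :=
    fun X a b => (htop X a b).1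
  have htopP : ∀ X : EuclideanSpace ℝ (Fin 3), 2 - η < X 2 → X 2 < 2 + η → P X = PG X :=
    fun X a b => (htop X a b).2
  have hbotU : ∀ X : EuclideanSpace ℝ (Fin 3), 1 - η < X 2 → X 2 < 1 + η → U X = G ((2 : ℝ) • X) :=
    fun X a b => (hbot X a b).1
  have hbotP : ∀ X : EuclideanSpace ℝ (Fin 3), 1 - η < X 2 → X 2 < 1 + η → P X = PG ((2 : ℝ) • X) :=
    fun X a b => (hbot X a b).2
  refine ⟨V, Q, F, cellToBand_contDiffOn hη hU htopU hbotU hV1 hV2 hV3,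
    cellToBand_contDiffOn hη hP htopP hbotP hQ1 hQ2 hQ3, ?_, ?_, ?_, ?_, ?_, hF, ?_⟩
  · -- divergence free on the open band: `fderiv V = fderiv U` there
    intro X h1 h2
    rw [(cellToBand_eventuallyEq hV2 h1 h2).fderiv_eq]
    exact hUdiv X h1 h2
  · -- steady Euler on the open band
    intro X h1 h2
    rw [(cellToBand_eventuallyEq hV2 h1 h2).fderiv_eq, hV2 X h1.le h2.le, cellToBand_gradient hQ2 h1 h2]
    exact hUE X h1 h2
  · -- dilation relation on `1/2 < z < 2`
    intro X h1 h2
    exact ⟨cellToBand_dilation hη htopU hbotU hV1 hV2 hV3 h1 h2,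
      cellToBand_dilation hη htopP hbotP hQ1 hQ2 hQ3 h1 h2⟩
  · -- horizontal periodicity on the closed band
    intro X h1 h2
    obtain ⟨a, b, c, d⟩ := hUper X h1 h2
    exact ⟨cellToBand_periodic hV2 (EuclideanSpace.single 0 (1 : ℝ)) (by simp) h1 h2 a,
      cellToBand_periodic hV2 (EuclideanSpace.single 1 (1 : ℝ)) (by simp) h1 h2 b,
      cellToBand_periodic hQ2 (EuclideanSpace.single 0 (1 : ℝ)) (by simp) h1 h2 c,
      cellToBand_periodic hQ2 (EuclideanSpace.single 1 (1 : ℝ)) (by simp) h1 h2 d⟩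
  · -- zero mass flux: the trace at `z = 1` is `G (2 •)`
    simp_rw [cellToBand_trace hη hbotU hV2]
    exact hm
  · -- the energy flux is the given `F`
    simp_rw [cellToBand_trace hη hbotU hV2, cellToBand_trace hη hbotP hQ2]
    exact he

end Summit.AnomalousDissipation.AnomalousDissipation.Theorems.HalfSpaceHierarchy

end
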